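import Literature.NumberTheory.AdelicBaseChange.CompletionBaseChange
import Mathlib.NumberTheory.NumberField.Basic
import Mathlib.NumberTheory.RamificationInertia.Basic
import HarnessLib

/-!
# Route `AdditiveKolyvaginRoad`, crux KS′ `LevelKolyvaginSystemsAdditive` (item stmt-BirchSwinnertonDyer-21396):
# THE SPLIT-COMPLETION BRICK `ℚ_v = K_w` at a prime split in the imaginary quadratic field — first brick of the
# valued-field bridge the congruence-transfer line `epsilon_matched_retyping` needs at TWO stubs
# (cell `pub/bsd-wall`, width seat `bsd-wall-akr-p2x-w2` g3; `--supports stmt-BirchSwinnertonDyer-21396`, helper)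

WHY THIS FILE. Line `epsilon_matched_retyping` of crux KS′ transfers W. Zhang's level systems from a good-ordinary
lender `E₀` to `E` along `E[p] ≅ E₀[p]`; its socket (`nonempty_levelKolyvaginSystemP_of_torsionCongr_tamagawa`,
akr-p2x-w3) consumes two LOCAL statements over the completions `K_w` of the imaginary quadratic field `K`:
(θK)ᵥ = `stub_kummerLineAtP` (E's Kummer line at `w ∣ p` is the transport of E₀'s) and `stub_tamagawaOffP`
(`p ∤ c_w(E⁄K)` at bad `w`). Both are PROVED over `ℚ` in the tree (`LagrangianSwitchAtP.map_kummer_eq_kummer_rat_of_p_parity`,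
p601209; `p ∤ ∏ c_ℓ(E)` is a frame hypothesis) and both wait on ONE piece of infrastructure (SWITCH-AT-P.md §2(iv);
STATUS akr-p2x-w3 g4 03:40Z): at a prime `ℓ` SPLIT in `K` (every `ℓ ∣ pN` is, by the Heegner hypothesis and the
line's `hsplit`), the completion `K_w` IS `ℚ_ℓ` — here in the tree's own currency, the canonical map
`ℚ_v → K_w` of the vendored FLT adelic base-change packet (`Extension.adicCompletionSemialgHom`, the `K_v`-algebra
structure on `L_w`), with `v = w ∩ 𝓞 ℚ`.

WHAT (pure algebraic number theory; no elliptic curves).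
* §1 `algebraMap_adicCompletion_bijective_of_eq_one` — for number fields `F ⊆ K`, `w ∣ v` with `e(w|v) = f(w|v) = 1`:
  `ℚ`… `F_v → K_w` is a bijection (`e·f = [K_w : F_v]`, FLT's `ramificationIdx_mul_inertiaDeg_eq_finrank`, so the
  degree is `1` and `⊥ = ⊤` as `F_v`-subalgebras);
* §2 `ramificationIdx_eq_one_of_card_primesOver` ∕ `inertiaDeg_eq_one_of_card_primesOver` — for `[K : ℚ] = 2` and a
  rational prime `p` with TWO primes of `𝓞 K` above it (the route's `hsplit`:
  `((Ideal.span {(p : ℤ)}).primesOver (𝓞 K)).ncard = 2`), every `w ∋ p` has `e(w|ℤ) = f(w|ℤ) = 1`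
  (`Σ_{w ∣ p} e f = [K : ℚ]`, Mathlib `Ideal.sum_ramification_inertia`, each term `≥ 1`), and the same over `𝓞 ℚ`
  (towers `ℤ → 𝓞 ℚ → 𝓞 K`, Mathlib `ramificationIdx'_algebra_tower` ∕ `inertiaDeg'_algebra_tower`);
* §3 `algebraMap_adicCompletion_bijective_of_split` — the brick: under `hsplit`, for every `w ∋ p`,
  `ℚ_v → K_w` (`v = w.under (𝓞 ℚ)`, which contains `p`: `natCast_mem_under`) is a continuous bijection of fields.

HONEST FRAMING: theorems only; 0 definitions, 0 named facts, 0 `sorry`. Closes nothing: it is the first of the three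
bricks of the bridge (next: transport of `H¹(K_w, E[p])` ∕ the Kummer condition, and of `localTamagawaNumber`, along
this bijection); KS′ is not proved here and BSD is NOT proved by any of this.

References: [cite: CasselsFrohlichANT1967, Ch. II §10 Theorem (10.2)] [cite: NeukirchANT1999, Ch. II §8 (8.2), (8.5)].
-/

-- single-conjunct summit: `Summit.BirchSwinnertonDyer.BirchSwinnertonDyer.…` repeats the name by design
set_option linter.dupNamespace false
set_option autoImplicit false

noncomputable section

namespace Summit.BirchSwinnertonDyer.BirchSwinnertonDyer.Theorems.AdditiveKoly.SplitCompletion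

open NumberField IsDedekindDomain

/-! ## §1 Degree one: `F_v → K_w` is a bijection when `e(w|v) = f(w|v) = 1` -/

/-- **`e(w|v) = f(w|v) = 1 ⟹ F_v = K_w`.** For number fields `F ⊆ K`, a finite place `v` of `F` and `w ∣ v` with
ramification index and inertia degree `1`, the canonical map of completions `F_v → K_w` (the `F_v`-algebra structure of
the adelic base-change packet) is bijective: `[K_w : F_v] = e f = 1`.
[cite: CasselsFrohlichANT1967, Ch. II §10 Theorem (10.2)] -/
theorem algebraMap_adicCompletion_bijective_of_eq_one (F K : Type) [Field F] [NumberField F] [Field K]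
    [NumberField K] [Algebra F K] (v : HeightOneSpectrum (𝓞 F)) (w : v.Extension (𝓞 K))
    (he : w.1.asIdeal.ramificationIdx (𝓞 F) = 1) (hf : w.1.asIdeal.inertiaDeg (𝓞 F) = 1) :
    Function.Bijective (algebraMap (v.adicCompletion F) (w.1.adicCompletion K)) := by
  have h1 : Module.finrank (v.adicCompletion F) (w.1.adicCompletion K) = 1 := by
    rw [← IsDedekindDomain.HeightOneSpectrum.adicCompletion.ramificationIdx_mul_inertiaDeg_eq_finrank
      (K := F) (L := K) w, he, hf]
  refine ⟨(algebraMap (v.adicCompletion F) (w.1.adicCompletion K)).injective, fun y ↦ ?_⟩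
  have htop : (⊥ : Subalgebra (v.adicCompletion F) (w.1.adicCompletion K)) = ⊤ :=
    Subalgebra.bot_eq_top_of_finrank_eq_one h1
  have hy : y ∈ (⊥ : Subalgebra (v.adicCompletion F) (w.1.adicCompletion K)) := by
    rw [htop]; exact Algebra.mem_top
  exact Algebra.mem_bot.mp hy

/-! ## §2 Two primes above `p` in a quadratic field: `e = f = 1` -/

section Quadratic

variable (K : Type) [Field K] [NumberField K] (p : ℕ) [Fact p.Prime]

/-- The ideal `pℤ` of a rational prime is maximal. [folklore] -/
theorem isMaximal_span_int : (Ideal.span {(p : ℤ)}).IsMaximal :=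
  ((Ideal.span_singleton_prime (by exact_mod_cast (Fact.out : p.Prime).ne_zero)).mpr
    (Nat.prime_iff_prime_int.mp Fact.out)).isMaximal
    (by rw [Ne, Ideal.span_singleton_eq_bot]; exact_mod_cast (Fact.out : p.Prime).ne_zero)

/-- A prime `w` of `𝓞 K` containing the rational prime `p` lies over `pℤ`. [folklore] -/
theorem liesOver_span_int (w : HeightOneSpectrum (𝓞 K)) (hw : ((p : ℕ) : 𝓞 K) ∈ w.asIdeal) :
    w.asIdeal.LiesOver (Ideal.span {(p : ℤ)}) := by
  refine (Ideal.liesOver_iff _ _).mpr ?_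
  haveI : w.asIdeal.IsMaximal := w.isMaximal
  haveI := isMaximal_span_int p
  refine (Ideal.IsMaximal.eq_of_le inferInstance (Ideal.IsMaximal.under ℤ w.asIdeal).ne_top ?_)
  rw [Ideal.span_le, Set.singleton_subset_iff, SetLike.mem_coe, Ideal.under_def, Ideal.mem_comap]
  simpa using hw

/-- **Two primes above `p` in a quadratic field force `e(w|p) f(w|p) = 1`.** If `[K : ℚ] = 2` and exactly two primes
of `𝓞 K` lie over `pℤ`, then for every prime `w ∋ p`: `e(w|ℤ) · f(w|ℤ) = 1` — from `Σ_{w ∣ p} e f = [K : ℚ] = 2`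
with both terms `≥ 1`. [cite: NeukirchANT1999, Ch. I §8 (8.2)] -/
theorem ramificationIdx_mul_inertiaDeg_eq_one_int (hK : Module.finrank ℚ K = 2)
    (hsplit : ((Ideal.span {(p : ℤ)}).primesOver (𝓞 K)).ncard = 2)
    (w : HeightOneSpectrum (𝓞 K)) (hw : ((p : ℕ) : 𝓞 K) ∈ w.asIdeal) :
    w.asIdeal.ramificationIdx ℤ * w.asIdeal.inertiaDeg ℤ = 1 := by
  haveI := isMaximal_span_int p
  haveI := liesOver_span_int K p w hw
  haveI : w.asIdeal.IsMaximal := w.isMaximal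
  have hne : (Ideal.span {(p : ℤ)}) ≠ ⊥ := by
    rw [Ne, Ideal.span_singleton_eq_bot]; exact_mod_cast (Fact.out : p.Prime).ne_zero
  -- Σ_{P ∣ p} e(P) f(P) = [K : ℚ] = 2
  have hsum := Ideal.sum_ramification_inertia (𝓞 K) ℚ K (p := Ideal.span {(p : ℤ)}) hne
  rw [hK] at hsum
  -- the sum has exactly two terms
  have hcard : (IsDedekindDomain.primesOverFinset (Ideal.span {(p : ℤ)}) (𝓞 K)).card = 2 := by
    rw [← Set.ncard_coe_finset, IsDedekindDomain.coe_primesOverFinset hne (𝓞 K), hsplit]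
  -- every term is ≥ 1
  have hge : ∀ P ∈ IsDedekindDomain.primesOverFinset (Ideal.span {(p : ℤ)}) (𝓞 K),
      1 ≤ (Ideal.span {(p : ℤ)}).ramificationIdx' P * (Ideal.span {(p : ℤ)}).inertiaDeg' P := by
    intro P hP
    rw [IsDedekindDomain.mem_primesOverFinset_iff hne] at hP
    haveI : P.IsPrime := hP.1
    haveI : P.LiesOver (Ideal.span {(p : ℤ)}) := hP.2
    have hPne : P ≠ ⊥ := Ideal.ne_bot_of_mem_primesOver hne hP
    haveI : P.IsMaximal := hP.1.isMaximal hPne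
    have he : (Ideal.span {(p : ℤ)}).ramificationIdx' P ≠ 0 :=
      Ideal.IsDedekindDomain.ramificationIdx'_ne_zero
        (by
          rw [Ne, Ideal.map_eq_bot_iff_of_injective (algebraMap ℤ (𝓞 K)).injective_int]
          exact hne)
        hP.1 (Ideal.map_le_iff_le_comap.mpr (le_of_eq ((Ideal.over_def P _).trans (Ideal.under_def ℤ P))))
    have hf : 0 < (Ideal.span {(p : ℤ)}).inertiaDeg' P := by
      rw [Ideal.inertiaDeg'_eq_inertiaDeg]
      exact Ideal.inertiaDeg_pos P ℤ
    exact Nat.one_le_iff_ne_zero.mpr (Nat.mul_ne_zero he (Nat.pos_iff_ne_zero.mp hf))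
  -- hence every term is exactly 1, in particular the one at `w`
  have hwmem : w.asIdeal ∈ IsDedekindDomain.primesOverFinset (Ideal.span {(p : ℤ)}) (𝓞 K) := by
    rw [IsDedekindDomain.mem_primesOverFinset_iff hne]
    exact ⟨w.isPrime, inferInstance⟩
  have hle2 : ∑ P ∈ IsDedekindDomain.primesOverFinset (Ideal.span {(p : ℤ)}) (𝓞 K), (1 : ℕ) ≤
      ∑ P ∈ IsDedekindDomain.primesOverFinset (Ideal.span {(p : ℤ)}) (𝓞 K),
        (Ideal.span {(p : ℤ)}).ramificationIdx' P * (Ideal.span {(p : ℤ)}).inertiaDeg' P :=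
    Finset.sum_le_sum hge
  have heq : (Ideal.span {(p : ℤ)}).ramificationIdx' w.asIdeal * (Ideal.span {(p : ℤ)}).inertiaDeg' w.asIdeal = 1 := by
    by_contra hne1
    have hgt : 1 < (Ideal.span {(p : ℤ)}).ramificationIdx' w.asIdeal *
        (Ideal.span {(p : ℤ)}).inertiaDeg' w.asIdeal :=
      lt_of_le_of_ne (hge _ hwmem) (Ne.symm hne1)
    have hlt := Finset.sum_lt_sum hge ⟨w.asIdeal, hwmem, hgt⟩
    simp only [Finset.sum_const, smul_eq_mul, mul_one, hcard] at hlt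
    omega
  rwa [Ideal.ramificationIdx'_eq_ramificationIdx _ _ hne, Ideal.inertiaDeg'_eq_inertiaDeg] at heq

omit [Fact p.Prime] in
/-- The prime of `𝓞 ℚ` below a prime `w ∋ p` of `𝓞 K` contains `p`. [folklore] -/
theorem natCast_mem_under (w : HeightOneSpectrum (𝓞 K)) (hw : ((p : ℕ) : 𝓞 K) ∈ w.asIdeal) :
    ((p : ℕ) : 𝓞 ℚ) ∈ (w.under (𝓞 ℚ)).asIdeal := by
  rw [HeightOneSpectrum.under_asIdeal, Ideal.under_def, Ideal.mem_comap, map_natCast]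
  exact hw

/-- **`e(w | 𝓞 ℚ) = 1` at a prime above a split `p` of a quadratic field** (tower `ℤ → 𝓞 ℚ → 𝓞 K`:
`e(w|ℤ) = e(v|ℤ) e(w|v)` with `e(w|ℤ) = 1`). [cite: NeukirchANT1999, Ch. I §8 (8.2), Ch. II §8 (8.5)] -/
theorem ramificationIdx_eq_one_of_card_primesOver (hK : Module.finrank ℚ K = 2)
    (hsplit : ((Ideal.span {(p : ℤ)}).primesOver (𝓞 K)).ncard = 2)
    (w : HeightOneSpectrum (𝓞 K)) (hw : ((p : ℕ) : 𝓞 K) ∈ w.asIdeal) :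
    w.asIdeal.ramificationIdx (𝓞 ℚ) = 1 := by
  have h := ramificationIdx_mul_inertiaDeg_eq_one_int K p hK hsplit w hw
  have he : w.asIdeal.ramificationIdx ℤ = 1 := Nat.eq_one_of_mul_eq_one_right h
  haveI := isMaximal_span_int p
  haveI := liesOver_span_int K p w hw
  haveI : w.asIdeal.IsPrime := w.isPrime
  have hne : (Ideal.span {(p : ℤ)}) ≠ ⊥ := by
    rw [Ne, Ideal.span_singleton_eq_bot]; exact_mod_cast (Fact.out : p.Prime).ne_zero
  have hvne : (w.under (𝓞 ℚ)).asIdeal ≠ ⊥ := (w.under (𝓞 ℚ)).ne_bot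
  haveI : (w.under (𝓞 ℚ)).asIdeal.IsPrime := (w.under (𝓞 ℚ)).isPrime
  haveI : w.asIdeal.LiesOver (w.under (𝓞 ℚ)).asIdeal := by
    rw [HeightOneSpectrum.under_asIdeal]; infer_instance
  -- tower formula `e(w|ℤ) = e(v|ℤ) · e(w|v)`
  have htower := Ideal.ramificationIdx'_algebra_tower (R := ℤ) (S := 𝓞 ℚ) (T := 𝓞 K)
    (p := Ideal.span {(p : ℤ)}) (P := (w.under (𝓞 ℚ)).asIdeal) (Q := w.asIdeal)
    (by
      rw [Ne, Ideal.map_eq_bot_iff_of_injective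
        (FaithfulSMul.algebraMap_injective (𝓞 ℚ) (𝓞 K))]
      exact hvne)
    (by
      rw [Ne, Ideal.map_eq_bot_iff_of_injective (algebraMap ℤ (𝓞 K)).injective_int]
      exact hne)
    (Ideal.map_le_iff_le_comap.mpr (le_of_eq ((HeightOneSpectrum.under_asIdeal (𝓞 ℚ) w).trans
      (Ideal.under_def (𝓞 ℚ) w.asIdeal))))
  rw [Ideal.ramificationIdx'_eq_ramificationIdx _ _ hne, he] at htower
  rw [← Ideal.ramificationIdx'_eq_ramificationIdx (w.under (𝓞 ℚ)).asIdeal w.asIdeal hvne]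
  exact (Nat.eq_one_of_mul_eq_one_left htower.symm)

/-- **`f(w | 𝓞 ℚ) = 1` at a prime above a split `p` of a quadratic field** (tower `ℤ → 𝓞 ℚ → 𝓞 K`:
`f(w|ℤ) = f(v|ℤ) f(w|v)` with `f(w|ℤ) = 1`). [cite: NeukirchANT1999, Ch. I §8 (8.2), Ch. II §8 (8.5)] -/
theorem inertiaDeg_eq_one_of_card_primesOver (hK : Module.finrank ℚ K = 2)
    (hsplit : ((Ideal.span {(p : ℤ)}).primesOver (𝓞 K)).ncard = 2)
    (w : HeightOneSpectrum (𝓞 K)) (hw : ((p : ℕ) : 𝓞 K) ∈ w.asIdeal) :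
    w.asIdeal.inertiaDeg (𝓞 ℚ) = 1 := by
  have h := ramificationIdx_mul_inertiaDeg_eq_one_int K p hK hsplit w hw
  have hf : w.asIdeal.inertiaDeg ℤ = 1 := Nat.eq_one_of_mul_eq_one_left h
  haveI := isMaximal_span_int p
  haveI := liesOver_span_int K p w hw
  haveI : w.asIdeal.IsMaximal := w.isMaximal
  haveI : (w.under (𝓞 ℚ)).asIdeal.IsMaximal := (w.under (𝓞 ℚ)).isMaximal
  haveI : w.asIdeal.LiesOver (w.under (𝓞 ℚ)).asIdeal := by
    rw [HeightOneSpectrum.under_asIdeal]; infer_instance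
  haveI : (w.under (𝓞 ℚ)).asIdeal.LiesOver (Ideal.span {(p : ℤ)}) := by
    rw [HeightOneSpectrum.under_asIdeal]; infer_instance
  -- tower formula `f(w|ℤ) = f(v|ℤ) · f(w|v)`
  have htower := Ideal.inertiaDeg'_algebra_tower (Ideal.span {(p : ℤ)}) (w.under (𝓞 ℚ)).asIdeal w.asIdeal
  rw [Ideal.inertiaDeg'_eq_inertiaDeg, hf] at htower
  rw [← Ideal.inertiaDeg'_eq_inertiaDeg (w.under (𝓞 ℚ)).asIdeal w.asIdeal]
  exact (Nat.eq_one_of_mul_eq_one_left htower.symm)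

/-! ## §3 The brick: `ℚ_v = K_w` at a prime split in the quadratic field -/

/-- **THE SPLIT-COMPLETION BRICK.** `K` a quadratic field, `p` a rational prime with exactly two primes of `𝓞 K`
above it (`hsplit`, the currency of line `epsilon_matched_retyping`), `w ∋ p` one of them, `v = w ∩ 𝓞 ℚ` (a prime of
`𝓞 ℚ` containing `p`, `natCast_mem_under`): the canonical continuous map of completions `ℚ_v → K_w` is a BIJECTION of
fields. This is the tree-currency form of "`K_w = ℚ_p` at a split prime" that the transports of the Kummer condition
at `w ∣ p` ((θK)ᵥ) and of the local Tamagawa number at bad `w` wait on. [cite: NeukirchANT1999, Ch. II §8 (8.5)]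
[cite: CasselsFrohlichANT1967, Ch. II §10 Theorem (10.2)] -/
theorem algebraMap_adicCompletion_bijective_of_split (hK : Module.finrank ℚ K = 2)
    (hsplit : ((Ideal.span {(p : ℤ)}).primesOver (𝓞 K)).ncard = 2)
    (w : HeightOneSpectrum (𝓞 K)) (hw : ((p : ℕ) : 𝓞 K) ∈ w.asIdeal)
    (w' : (w.under (𝓞 ℚ)).Extension (𝓞 K)) (hw' : w'.1 = w) :
    Function.Bijective (algebraMap ((w.under (𝓞 ℚ)).adicCompletion ℚ) (w'.1.adicCompletion K)) := by
  refine algebraMap_adicCompletion_bijective_of_eq_one ℚ K (w.under (𝓞 ℚ)) w' ?_ ?_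
  · rw [hw']; exact ramificationIdx_eq_one_of_card_primesOver K p hK hsplit w hw
  · rw [hw']; exact inertiaDeg_eq_one_of_card_primesOver K p hK hsplit w hw

end Quadratic

end Summit.BirchSwinnertonDyer.BirchSwinnertonDyer.Theorems.AdditiveKoly.SplitCompletion

end
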